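import Summits.HodgeConjecture.CorCM.IrreducibleOddWeights
import HarnessLib

/-!
# Irreducible odd weights, CM-type dress: every CM type is nondegenerate, same-slot families are decided by
# equivariant relations, and without multiplicity one the capacity is at most `n/2`

COR-CM (cell `pub-hodgecm2`, binder seat `b16` gen 55, count-neutral claim IRR-ODD, file F1b — the `A = Anti` reading of
F1 `CorCM/IrreducibleOddWeights` (abstract `G`-set level); theorems only, no definition, no named fact, no `sorry`).
NEW as stated, hence under `Summits/`.  HONEST FRAMING: finite-dimensional linear algebra about the Kubota–Dodson rank
of CM types for a conjugation `ρ` commuting with `G` on one slot set `X` (`|X| = 2n`) and of same-slot families, read on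
Hodge groups of products of abelian varieties with complex multiplication by ONE field; `HC_CM` is neither used nor
asserted.

(IRR) for the slot: every non-zero `G`-stable subspace of the `ρ`-odd weights `Anti = {f : f(ρx) = −f(x)}` is `Anti`
(hypothesis shape `∀ W ≤ Anti, W ≠ ⊥ → stable → W = Anti`, the `hirr` shape of gens 51–54).  (M1) = multiplicity one
(every equivariant odd-valued endomorphism of `ℚ^X` is `c·(f ↦ f − f∘ρ)`; ⟺ (SC) for CM fields, seat gen 54).

* `comp_smul_mem_antiWeights`, `antiSpan_eq_antiWeights_of_irreducible`, **`typeRank_eq_of_irreducible`** (EVERY CM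
  type of an (IRR) slot is nondegenerate: `rank = |X|/2 + 1`), `antiSpan_irreducible_of_irreducible` (the `hirr` input of
  the Goursat / coefficient / orbit criteria, now WITHOUT multiplicity one), `antiWeights_irreducible_of_multiplicityOne`
  ((M1) ⟹ (IRR)).
* `typeRank_sigmaType_add_card_eq_iff_forall_equivariant`, `typeRank_sigmaType_eq_iff_forall_equivariant` (THE CRITERION:
  a same-slot family of CM types of an (IRR) slot is additive / nondegenerate IFF its type vectors satisfy no equivariant
  relation `Σ_i φ_i(u_i) = 0`, `φ_i u_i ≠ 0`), `typeRank_sigmaType_eq_iff_not_exists_equivariant` (two types: IFF no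
  equivariant endomorphism carries one type vector to the other).
* `card_mul_le_of_irreducible` (capacity `|I|·d ≤ n`), **`two_mul_card_le_of_irreducible_of_not_multiplicityOne`**:
  (IRR) WITHOUT (M1) ⟹ every nondegenerate same-slot family has at most `n/2` members (against `n` under (M1)).

## References

* [Serre1977] J.-P. Serre, *Linear Representations of Finite Groups*, GTM 42 (1977), §1.3 Thm. 1, §2.2 Prop. 4,
  §12.1–12.2.
* [Mai1989] L. Mai, *Lower bounds for the ranks of CM types*, J. Number Theory 32 (1989), §2 Prop. 1 (proof).
* [Kubota1965] T. Kubota, *On the field extension by complex multiplication*, Trans. AMS 118 (1965), §2 Lemma 2.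
* [Gordon1999HodgeAVSurvey] B. B. Gordon, *A survey of the Hodge conjecture for abelian varieties*, §3 Theorem, 7.5–7.7.
-/

set_option autoImplicit false

noncomputable section

open scoped BigOperators

universe u v w

namespace Summit.HodgeConjecture.CorCM.IrrOdd

open Literature.NumberTheory.ComplexMultiplication

variable {G : Type w} [Group G] {I : Type u} {X : Type v} [MulAction G X]


/-! ### §5 CM types: `A = Anti`, the `ρ`-odd weights -/

section CMType

variable {ρ : G}

/-- The odd weights are `G`-stable when `ρ` commutes with `G` on `X`. [cite: Kubota1965, §2 (p. 115)] -/
theorem comp_smul_mem_antiWeights (hcomm : ∀ (g : G) (x : X), g • ρ • x = ρ • g • x) (k : G) (a : X → ℚ)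
    (ha : a ∈ antiWeights (E := X) ρ) : (fun x => a (k • x)) ∈ antiWeights (E := X) ρ := fun x => by
  change a (k • ρ • x) = -a (k • x)
  rw [hcomm]
  exact ha _

/-- **`U(Φ) = Anti` for every CM type of an (IRR) slot.** [cite: Kubota1965, §2 Lemma 2] [cite: Serre1977, §2.2 Prop. 4] -/
theorem antiSpan_eq_antiWeights_of_irreducible [Nonempty X] {Φ : Set X} (h : IsCMTypeWith ρ Φ)
    (hirr : ∀ W : Submodule ℚ (X → ℚ), W ≤ antiWeights (E := X) ρ → W ≠ ⊥ →
      (∀ (k : G) (f : X → ℚ), f ∈ W → (fun y => f (k • y)) ∈ W) → W = antiWeights (E := X) ρ) :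
    antiSpan G Φ = antiWeights (E := X) ρ :=
  antiSpan_eq_of_irreducible (comp_smul_mem_antiWeights h.comm) hirr (antiVec_mem_antiWeights h 1)

/-- **EVERY CM TYPE OF AN (IRR) SLOT IS NONDEGENERATE**: `rank(Φ) = |X|/2 + 1` (on abelian varieties:
`dim MT(A_Φ) = dim A_Φ + 1`, `B• = D•` on all powers of `A_Φ`). [cite: Kubota1965, §2 Lemma 2] [cite: Mai1989, §2 Prop. 1 (proof)] -/
theorem typeRank_eq_of_irreducible [Fintype X] [Nonempty X] {Φ : Set X} (h : IsCMTypeWith ρ Φ)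
    (hirr : ∀ W : Submodule ℚ (X → ℚ), W ≤ antiWeights (E := X) ρ → W ≠ ⊥ →
      (∀ (k : G) (f : X → ℚ), f ∈ W → (fun y => f (k • y)) ∈ W) → W = antiWeights (E := X) ρ) :
    typeRank G Φ = Fintype.card X / 2 + 1 :=
  h.typeRank_eq_iff_antiSpan_eq.2 (antiSpan_eq_antiWeights_of_irreducible h hirr)

/-- **`U(Φ)` is irreducible for every CM type of an (IRR) slot** — the `hirr` hypothesis of the Goursat dichotomy, of
the coefficient criterion (`CorCM/PairFlipSlotCoefficientCriterion`) and of the orbit criterion (`CorCM/StabiliserOrbitKernel`),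
now WITHOUT multiplicity one. [cite: Serre1977, §2.2 Prop. 4] -/
theorem antiSpan_irreducible_of_irreducible [Nonempty X] {Φ : Set X} (h : IsCMTypeWith ρ Φ)
    (hirr : ∀ W : Submodule ℚ (X → ℚ), W ≤ antiWeights (E := X) ρ → W ≠ ⊥ →
      (∀ (k : G) (f : X → ℚ), f ∈ W → (fun y => f (k • y)) ∈ W) → W = antiWeights (E := X) ρ)
    (W : Submodule ℚ (X → ℚ)) (hW : W ≤ antiSpan G Φ) (hW0 : W ≠ ⊥)
    (hst : ∀ (k : G) (f : X → ℚ), f ∈ W → (fun y => f (k • y)) ∈ W) : W = antiSpan G Φ := by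
  rw [antiSpan_eq_antiWeights_of_irreducible h hirr] at hW ⊢
  exact hirr W hW hW0 hst

/-- **(M1) ⟹ (IRR)**: multiplicity one of the odd weights (every equivariant odd-valued endomorphism of `ℚ^X` is a
multiple of `f ↦ f − f∘ρ`) makes `Anti` irreducible (apply (M1) to the orthogonal projection onto a stable subspace;
the tree's `eq_bot_or_eq_of_multiplicityOne`). [cite: Serre1977, §1.3 Thm. 1 and §2.2 Prop. 4] -/
theorem antiWeights_irreducible_of_multiplicityOne [Fintype X] (hi : ∀ x : X, ρ • ρ • x = x)
    (hM1 : ∀ T : (X → ℚ) →ₗ[ℚ] (X → ℚ),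
      (∀ (g : G) (f : X → ℚ), T (fun x => f (g⁻¹ • x)) = fun x => T f (g⁻¹ • x)) →
      (∀ (f : X → ℚ) (x : X), T f (ρ • x) = -T f x) → ∃ c : ℚ, ∀ f, T f = c • fun x => f x - f (ρ • x))
    (W : Submodule ℚ (X → ℚ)) (hW : W ≤ antiWeights (E := X) ρ) (hW0 : W ≠ ⊥)
    (hst : ∀ (k : G) (f : X → ℚ), f ∈ W → (fun y => f (k • y)) ∈ W) : W = antiWeights (E := X) ρ := by
  let A : Submodule ℚ (X → ℚ) := antiWeights ρ
  have hmemA : ∀ f : X → ℚ, f ∈ A ↔ ∀ x, f (ρ • x) = -f x := fun f => Iff.rfl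
  let P : (X → ℚ) →ₗ[ℚ] (X → ℚ) := (1 / 2 : ℚ) • (LinearMap.id - LinearMap.funLeft ℚ ℚ fun x : X => ρ • x)
  have hP : ∀ f x, P f x = (1 / 2 : ℚ) * (f x - f (ρ • x)) := fun f x => rfl
  have hPid : ∀ a ∈ A, P a = a := fun a ha => by
    funext x
    rw [hP, (hmemA a).1 ha x]
    ring
  have hM1' : ∀ T : (X → ℚ) →ₗ[ℚ] (X → ℚ),
      (∀ (g : G) (f : X → ℚ), T (fun x => f (g⁻¹ • x)) = fun x => T f (g⁻¹ • x)) →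
      (∀ f, T f ∈ A) → ∃ c : ℚ, ∀ f, T f = c • P f := fun T hT hTA => by
    obtain ⟨c, hcT⟩ := hM1 T hT fun f => (hmemA _).1 (hTA f)
    refine ⟨2 * c, fun f => ?_⟩
    rw [hcT f]
    funext x
    simp only [Pi.smul_apply, hP, smul_eq_mul]
    ring
  have _ := hi
  exact (eq_bot_or_eq_of_multiplicityOne (G := G) P hPid hM1' hW fun k f hf => hst k f hf).resolve_left hW0

variable [DecidableEq I] [Fintype I] [Fintype X] [Nonempty X]

/-- **THE CRITERION, rank form, for CM types of an (IRR) slot**: `rank(Σ) + |I| = Σ_i rank(Φ_i) + 1`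
(`Hg(∏ A_i) = ∏ Hg(A_i)`) IFF the type vectors satisfy no equivariant relation.
[cite: Mai1989, §2 Prop. 1 (proof)] [cite: Gordon1999HodgeAVSurvey, §3 Theorem (1) and 7.5–7.7] -/
theorem typeRank_sigmaType_add_card_eq_iff_forall_equivariant [Nonempty I] (Φ : I → Set X)
    (h : ∀ i, IsCMTypeWith ρ (Φ i))
    (hirr : ∀ W : Submodule ℚ (X → ℚ), W ≤ antiWeights (E := X) ρ → W ≠ ⊥ →
      (∀ (k : G) (f : X → ℚ), f ∈ W → (fun y => f (k • y)) ∈ W) → W = antiWeights (E := X) ρ) :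
    typeRank G (sigmaType (E := fun _ : I => X) Φ) + Fintype.card I = (∑ i, typeRank G (Φ i)) + 1 ↔
      ∀ φ : I → ((X → ℚ) →ₗ[ℚ] (X → ℚ)),
        (∀ i (g : G) (f : X → ℚ), φ i (fun x => f (g⁻¹ • x)) = fun x => φ i f (g⁻¹ • x)) →
        ∑ i, φ i (antiVec (Φ i) (1 : G)) = 0 → ∀ i, φ i (antiVec (Φ i) (1 : G)) = 0 := by
  rw [← forall_map_slotExt_le_iff_typeRank_sigmaType_add_card_eq (E := fun _ : I => X) h]
  exact forall_map_slotExt_le_iff_forall_equivariant (comp_smul_mem_antiWeights (h (Classical.arbitrary I)).comm)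
    hirr Φ fun i => antiVec_mem_antiWeights (h i) 1

/-- **Nondegeneracy form** (every member is nondegenerate by `typeRank_eq_of_irreducible`): the family is nondegenerate,
`rank(Σ) = |⊔ X|/2 + 1`, IFF the type vectors satisfy no equivariant relation. [cite: Gordon1999HodgeAVSurvey, 7.5–7.7]
[cite: Mai1989, §2 Prop. 1 (proof)] -/
theorem typeRank_sigmaType_eq_iff_forall_equivariant [Nonempty I] (Φ : I → Set X) (h : ∀ i, IsCMTypeWith ρ (Φ i))
    (hirr : ∀ W : Submodule ℚ (X → ℚ), W ≤ antiWeights (E := X) ρ → W ≠ ⊥ →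
      (∀ (k : G) (f : X → ℚ), f ∈ W → (fun y => f (k • y)) ∈ W) → W = antiWeights (E := X) ρ) :
    typeRank G (sigmaType (E := fun _ : I => X) Φ) = Fintype.card (Σ _ : I, X) / 2 + 1 ↔
      ∀ φ : I → ((X → ℚ) →ₗ[ℚ] (X → ℚ)),
        (∀ i (g : G) (f : X → ℚ), φ i (fun x => f (g⁻¹ • x)) = fun x => φ i f (g⁻¹ • x)) →
        ∑ i, φ i (antiVec (Φ i) (1 : G)) = 0 → ∀ i, φ i (antiVec (Φ i) (1 : G)) = 0 := by
  rw [← forall_map_slotExt_le_iff_typeRank_sigmaType_eq (E := fun _ : I => X) h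
    fun i => typeRank_eq_of_irreducible (h i) hirr]
  exact forall_map_slotExt_le_iff_forall_equivariant (comp_smul_mem_antiWeights (h (Classical.arbitrary I)).comm)
    hirr Φ fun i => antiVec_mem_antiWeights (h i) 1

/-- **Two CM types of an (IRR) slot: nondegenerate pair ⟺ no equivariant endomorphism carries `u_1(Φ_{i₁})` to
`u_1(Φ_{i₀})`** (`Hg(A₀ × A₁) = Hg(A₀) × Hg(A₁)` ⟺ `u_{i₀} ∉ D·u_{i₁}`). [cite: Gordon1999HodgeAVSurvey, §3 Theorem (proof) and 7.5–7.7] -/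
theorem typeRank_sigmaType_eq_iff_not_exists_equivariant {i₀ i₁ : I} (hI : ∀ j, j = i₀ ∨ j = i₁) (h01 : i₀ ≠ i₁)
    (Φ : I → Set X) (h : ∀ i, IsCMTypeWith ρ (Φ i))
    (hirr : ∀ W : Submodule ℚ (X → ℚ), W ≤ antiWeights (E := X) ρ → W ≠ ⊥ →
      (∀ (k : G) (f : X → ℚ), f ∈ W → (fun y => f (k • y)) ∈ W) → W = antiWeights (E := X) ρ) :
    typeRank G (sigmaType (E := fun _ : I => X) Φ) = Fintype.card (Σ _ : I, X) / 2 + 1 ↔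
      ¬ ∃ L : (X → ℚ) →ₗ[ℚ] (X → ℚ), (∀ (g : G) (f : X → ℚ), L (fun y => f (g • y)) = fun x => L f (g • x)) ∧
        L (antiVec (Φ i₁) (1 : G)) = antiVec (Φ i₀) (1 : G) := by
  haveI : Nonempty I := ⟨i₀⟩
  rw [← forall_map_slotExt_le_iff_typeRank_sigmaType_eq (E := fun _ : I => X) h
    fun i => typeRank_eq_of_irreducible (h i) hirr]
  exact forall_map_slotExt_le_iff_not_exists_equivariant hI h01 (comp_smul_mem_antiWeights (h i₀).comm) hirr Φ
    fun i => antiVec_mem_antiWeights (h i) 1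

/-- **Capacity for CM types of an (IRR) slot**: `d` odd-valued equivariant endomorphisms, linearly independent on
`Anti`, force `|I| · d ≤ |X|/2` for every nondegenerate same-slot family. [cite: Mai1989, §2 Prop. 1 (proof)]
[cite: Serre1977, §2.2 Prop. 4 and §12.2] -/
theorem card_mul_le_of_irreducible [Nonempty I] (Φ : I → Set X) (h : ∀ i, IsCMTypeWith ρ (Φ i))
    (hirr : ∀ W : Submodule ℚ (X → ℚ), W ≤ antiWeights (E := X) ρ → W ≠ ⊥ →
      (∀ (k : G) (f : X → ℚ), f ∈ W → (fun y => f (k • y)) ∈ W) → W = antiWeights (E := X) ρ)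
    (hnd : typeRank G (sigmaType (E := fun _ : I => X) Φ) = Fintype.card (Σ _ : I, X) / 2 + 1)
    {d : ℕ} (T : Fin d → ((X → ℚ) →ₗ[ℚ] (X → ℚ)))
    (hT : ∀ j (g : G) (f : X → ℚ), T j (fun x => f (g⁻¹ • x)) = fun x => T j f (g⁻¹ • x))
    (hTodd : ∀ j (f : X → ℚ) (x : X), T j f (ρ • x) = -T j f x)
    (hTli : ∀ c : Fin d → ℚ, (∀ a ∈ antiWeights (E := X) ρ, ∑ j, c j • T j a = 0) → ∀ j, c j = 0) :
    Fintype.card I * d ≤ Fintype.card X / 2 := by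
  have i₀ := Classical.arbitrary I
  have hadd := (forall_map_slotExt_le_iff_typeRank_sigmaType_eq (E := fun _ : I => X) h
    fun i => typeRank_eq_of_irreducible (h i) hirr).2 hnd
  rw [← finrank_antiWeights_eq_of_typeRank_eq (h i₀) (typeRank_eq_of_irreducible (h i₀) hirr)]
  exact card_mul_le_finrank_of_irreducible (comp_smul_mem_antiWeights (h i₀).comm) hirr Φ
    (fun i => antiVec_mem_antiWeights (h i) 1) hadd T hT (fun j f x => hTodd j f x) hTli

/-- **IRREDUCIBLE BUT NOT MULTIPLICITY ONE ⟹ CAPACITY AT MOST `n/2`.**  If the odd weights are irreducible but some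
odd-valued equivariant endomorphism `T` of `ℚ^X` is NOT a multiple of `P : f ↦ f − f∘ρ` (for a CM field: (IRR) holds and
(SC) fails, seat gen 54 `StabConj.stabConj_of_multiplicityOne`), then `P` and `T` are linearly independent on `Anti`
(both kill the even weights: `T(f∘ρ) = (Tf)∘ρ = −Tf`), so `d ≥ 2` in `card_mul_le_of_irreducible`: EVERY NONDEGENERATE
SAME-SLOT FAMILY HAS `2|I| ≤ |X|/2`, i.e. at most `n/2` members. [cite: Serre1977, §2.2 Prop. 4 and §12.2]
[cite: Mai1989, §2 Prop. 1 (proof)] [cite: Gordon1999HodgeAVSurvey, 7.7] -/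
theorem two_mul_card_le_of_irreducible_of_not_multiplicityOne [Nonempty I] (Φ : I → Set X)
    (h : ∀ i, IsCMTypeWith ρ (Φ i))
    (hirr : ∀ W : Submodule ℚ (X → ℚ), W ≤ antiWeights (E := X) ρ → W ≠ ⊥ →
      (∀ (k : G) (f : X → ℚ), f ∈ W → (fun y => f (k • y)) ∈ W) → W = antiWeights (E := X) ρ)
    (hM1 : ¬ ∀ T : (X → ℚ) →ₗ[ℚ] (X → ℚ),
      (∀ (g : G) (f : X → ℚ), T (fun x => f (g⁻¹ • x)) = fun x => T f (g⁻¹ • x)) →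
      (∀ (f : X → ℚ) (x : X), T f (ρ • x) = -T f x) → ∃ c : ℚ, ∀ f, T f = c • fun x => f x - f (ρ • x))
    (hnd : typeRank G (sigmaType (E := fun _ : I => X) Φ) = Fintype.card (Σ _ : I, X) / 2 + 1) :
    2 * Fintype.card I ≤ Fintype.card X / 2 := by
  have i₀ := Classical.arbitrary I
  have hρ := h i₀
  push Not at hM1
  obtain ⟨T, hT, hTodd, hTne⟩ := hM1
  -- the projection `P f = f − f∘ρ`
  let P : (X → ℚ) →ₗ[ℚ] (X → ℚ) := LinearMap.id - LinearMap.funLeft ℚ ℚ fun x : X => ρ • x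
  have hP : ∀ f, P f = fun x => f x - f (ρ • x) := fun f => rfl
  have hPeq : ∀ (g : G) (f : X → ℚ), P (fun x => f (g⁻¹ • x)) = fun x => P f (g⁻¹ • x) := fun g f => by
    rw [hP, hP]
    funext x
    simp only [hρ.comm]
  have hPodd : ∀ (f : X → ℚ) (x : X), P f (ρ • x) = -P f x := fun f x => by
    simp only [hP, hρ.invol]
    ring
  -- `T` kills `f∘ρ + f`: `T (f∘ρ) = −T f`
  have hTrho : ∀ f : X → ℚ, T (fun x => f (ρ • x)) = -T f := fun f => by
    have h1 := hT ρ⁻¹ f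
    rw [inv_inv] at h1
    rw [h1]
    funext x
    simp only [Pi.neg_apply, hTodd]
  have hTP : ∀ f : X → ℚ, T (P f) = (2 : ℚ) • T f := fun f => by
    have h1 : P f = f - fun x => f (ρ • x) := rfl
    rw [h1, map_sub, hTrho, two_smul, sub_neg_eq_add]
  have hPP : ∀ f : X → ℚ, P (P f) = (2 : ℚ) • P f := fun f => by
    funext x
    simp only [hP, Pi.smul_apply, smul_eq_mul, hρ.invol]
    ring
  -- independence of `P`, `T` on `Anti`
  let T₂ : Fin 2 → ((X → ℚ) →ₗ[ℚ] (X → ℚ)) := ![P, T]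
  have hT₂ : ∀ j (g : G) (f : X → ℚ), T₂ j (fun x => f (g⁻¹ • x)) = fun x => T₂ j f (g⁻¹ • x) := fun j => by
    fin_cases j
    · exact hPeq
    · exact hT
  have hT₂odd : ∀ j (f : X → ℚ) (x : X), T₂ j f (ρ • x) = -T₂ j f x := fun j => by
    fin_cases j
    · exact hPodd
    · exact hTodd
  have hT₂li : ∀ c : Fin 2 → ℚ, (∀ a ∈ antiWeights (E := X) ρ, ∑ j, c j • T₂ j a = 0) → ∀ j, c j = 0 := by
    intro c hc
    have hPA : ∀ f, P f ∈ antiWeights (E := X) ρ := fun f x => hPodd f x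
    have hall : ∀ f : X → ℚ, c 0 • P f + c 1 • T f = 0 := fun f => by
      have h1 := hc (P f) (hPA f)
      simp only [Fin.sum_univ_two, T₂, Matrix.cons_val_zero, Matrix.cons_val_one, hPP, hTP, smul_smul] at h1
      have h2 : (2 : ℚ) • (c 0 • P f + c 1 • T f) = 0 := by
        rw [smul_add, smul_smul, smul_smul, mul_comm (2 : ℚ) (c 0), mul_comm (2 : ℚ) (c 1)]
        exact h1
      exact (smul_eq_zero.1 h2).resolve_left two_ne_zero
    have hc1 : c 1 = 0 := by
      by_contra hc1
      obtain ⟨f, hf⟩ := hTne (-(c 0 / c 1))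
      apply hf
      change T f = -(c 0 / c 1) • P f
      have h3 : c 1 • T f = -(c 0 • P f) := eq_neg_of_add_eq_zero_right (hall f)
      have h4 : T f = (c 1)⁻¹ • (c 1 • T f) := by rw [smul_smul, inv_mul_cancel₀ hc1, one_smul]
      rw [h4, h3, smul_neg, smul_smul, div_eq_inv_mul, neg_smul]
    have hc0 : c 0 = 0 := by
      have hmemA : ∀ f : X → ℚ, f ∈ antiWeights (E := X) ρ ↔ ∀ x, f (ρ • x) = -f x := fun f => Iff.rfl
      have hPanti : ∀ a ∈ antiWeights (E := X) ρ, P a = (2 : ℚ) • a := fun a ha => by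
        funext x
        simp only [hP, Pi.smul_apply, smul_eq_mul, (hmemA a).1 ha x]
        ring
      have h1 := hall (antiVec (Φ i₀) (1 : G))
      rw [hc1, zero_smul, add_zero, hPanti _ (antiVec_mem_antiWeights hρ 1), smul_smul] at h1
      rcases smul_eq_zero.1 h1 with h3 | h3
      · exact (mul_eq_zero.1 h3).resolve_right two_ne_zero
      · exact absurd h3 (antiVec_one_ne_zero (Φ i₀))
    intro j
    fin_cases j
    · exact hc0
    · exact hc1
  have key := card_mul_le_of_irreducible Φ h hirr hnd T₂ hT₂ hT₂odd hT₂li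
  omega

end CMType

end Summit.HodgeConjecture.CorCM.IrrOdd

end
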